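import Summits.Ventures.PercRepro.GenQFundCircuit

/-!
# PercRepro — the charge of a basis from the singletons and pairs above it (night-4, gen 3; sheet §48, L1–L4)

For the type-`2` window through the charging form (`GenQChargeTwo.lean`): the charge received by a basis `B₀` of a
rank-`q` flat `G` is at least the charge from the `(q + 1)`- and `(q + 2)`-supersets of `B₀` alone (every term is
nonnegative), and the share from a singleton is bounded below through the fundamental circuit of the added point
(`GenQFundCircuit.lean`).

* `dem_two_eq_zero_of_card_le_one` — a set missing at most one point of `G` is demand-free at type `2`;
* `five_le_card_union_fc` — when every line has at most `3` points two fundamental `3`-circuits never share their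
  basis pair, so `#(C ∪ D) ≥ 5`;
* `charge_ge_sum_of_subset`, `charge_ge_singles_add_pairs` — the charge dominates the charge from any sub-family of
  supersets, in particular from the singletons `B₀ ∪ {x}` and the pairs `B₀ ∪ {x, y}`;
* `single_share_ge` — the share from `B₀ ∪ {x}` is at least `(q/(q + 2 − #C) − Φ_q·dem)/#C`.
-/

namespace PercRepro.GenQ

open Finset ThmH PerFlat SixFour ThmN

variable {α : Type*} [DecidableEq α] {M : Matroid α} [M.Finite]

/-! ## The demand indicator -/

/-- `dem ≤ 1`. -/
theorem dem_le_one (G B : Finset α) (t : ℕ) : dem M G t B ≤ 1 := by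
  unfold dem
  split_ifs <;> norm_num

/-- `0 ≤ dem`. -/
theorem dem_nonneg (G B : Finset α) (t : ℕ) : 0 ≤ dem M G t B := by
  unfold dem
  split_ifs <;> norm_num

/-- At type `2` a set missing at most one point of `G` is demand-free. -/
theorem dem_two_eq_zero_of_card_le_one {G B : Finset α} (h : (G \ B).card ≤ 1) : dem M G 2 B = 0 := by
  unfold dem
  rw [if_pos]
  have h1 : M.eRk ((G \ B : Finset α) : Set α) ≤ ((G \ B).card : ℕ∞) := by
    rw [← Set.encard_coe_eq_coe_finsetCard]
    exact M.eRk_le_encard _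
  have h2 : ((G \ B).card : ℕ∞) ≤ 1 := by exact_mod_cast h
  calc M.eRk ((G \ B : Finset α) : Set α) + 1 ≤ 1 + 1 := add_le_add (h1.trans h2) le_rfl
    _ = ((2 : ℕ) : ℕ∞) := by norm_num

/-! ## Two fundamental `3`-circuits never share their basis pair when lines have `≤ 3` points -/

omit [DecidableEq α] in
/-- The closure of a rank-`2` set is a rank-`2` flat (a line). -/
theorem clF_mem_flatsQ_two {T : Finset α} (hr : M.eRk (T : Set α) = 2) :
    clF M T ∈ flatsQ M 2 := by
  rw [mem_flatsQ, ← Finset.coe_subset, coe_clF, coe_gr]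
  exact ⟨M.closure_subset_ground _, M.isFlat_closure _, by rw [M.eRk_closure_eq, hr]; rfl⟩

/-- **`#(C ∪ D) ≥ 5`** for the fundamental circuits `C`, `D` of two points `x ≠ y` of `G ∖ B₀` when every line has
at most `3` points: two `3`-circuits `{x, a, b}`, `{y, a, b}` would put `x, y, a, b` on one line. -/
theorem five_le_card_union_fc (hs : Simple M) (hline : ∀ L ∈ flatsQ M 2, L.card ≤ 3) {G B₀ : Finset α} {q : ℕ}
    (hG : G ⊆ gr M) (hrG : M.eRk (G : Set α) = (q : ℕ∞)) (hB : B₀ ∈ basesOf M G q) (hq : 2 ≤ q) {x y : α}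
    (hx : x ∈ G) (hxB : x ∉ B₀) (hy : y ∈ G) (hyB : y ∉ B₀) (hxy : x ≠ y) :
    5 ≤ (fc M x B₀ ∪ fc M y B₀).card := by
  have hI := indep_of_mem_basesOf hB
  obtain ⟨hBG, hr, hc⟩ := mem_basesOf.1 hB
  have hne : B₀.Nonempty := Finset.card_pos.1 (by omega)
  have hxcl := mem_closure_of_mem_basesOf hG hrG hB hx
  have hycl := mem_closure_of_mem_basesOf hG hrG hB hy
  have h3x := three_le_card_fc hs (hBG.trans hG) (hG hx) hI hxcl hxB hne
  have h3y := three_le_card_fc hs (hBG.trans hG) (hG hy) hI hycl hyB hne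
  have hCx : M.IsCircuit ((fc M x B₀ : Finset α) : Set α) := isCircuit_fc hI hxcl hxB
  have hCy : M.IsCircuit ((fc M y B₀ : Finset α) : Set α) := isCircuit_fc hI hycl hyB
  -- `x ∉ D`, `y ∉ C`
  have hxD : x ∉ fc M y B₀ := fun h => by
    rcases Finset.mem_insert.1 (fc_subset_insert y B₀ h) with h' | h'
    · exact hxy h'
    · exact hxB h'
  have hyC : y ∉ fc M x B₀ := fun h => by
    rcases Finset.mem_insert.1 (fc_subset_insert x B₀ h) with h' | h'
    · exact hxy h'.symm
    · exact hyB h'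
  have hunion := Finset.card_union_add_card_inter (fc M x B₀) (fc M y B₀)
  -- `C ∩ D ⊆ C ∖ {x}` and `⊆ D ∖ {y}`
  have hsub1 : fc M x B₀ ∩ fc M y B₀ ⊆ (fc M x B₀).erase x := by
    intro e he
    rw [Finset.mem_inter] at he
    exact Finset.mem_erase.2 ⟨fun h => hxD (h ▸ he.2), he.1⟩
  have hsub2 : fc M x B₀ ∩ fc M y B₀ ⊆ (fc M y B₀).erase y := by
    intro e he
    rw [Finset.mem_inter] at he
    exact Finset.mem_erase.2 ⟨fun h => hyC (h ▸ he.1), he.2⟩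
  have hi1 := Finset.card_le_card hsub1
  have hi2 := Finset.card_le_card hsub2
  rw [Finset.card_erase_of_mem (mem_fc_self x B₀)] at hi1
  rw [Finset.card_erase_of_mem (mem_fc_self y B₀)] at hi2
  by_contra hlt
  push Not at hlt
  -- hence both circuits have `3` points and share their two basis points
  have hcx : (fc M x B₀).card = 3 := by omega
  have hcy : (fc M y B₀).card = 3 := by omega
  have hint : (fc M x B₀ ∩ fc M y B₀).card = 2 := by omega
  set T := (fc M x B₀).erase x with hTdef
  have hTeq : fc M x B₀ ∩ fc M y B₀ = T :=
    Finset.eq_of_subset_of_card_le hsub1 (by rw [hint, hTdef, Finset.card_erase_of_mem (mem_fc_self x B₀), hcx])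
  have hTeq' : fc M x B₀ ∩ fc M y B₀ = (fc M y B₀).erase y :=
    Finset.eq_of_subset_of_card_le hsub2 (by rw [hint, Finset.card_erase_of_mem (mem_fc_self y B₀), hcy])
  have hTB : T ⊆ B₀ := by
    intro e he
    rw [hTdef, Finset.mem_erase] at he
    rcases Finset.mem_insert.1 (fc_subset_insert x B₀ he.2) with h' | h'
    · exact absurd h' he.1
    · exact h'
  have hTcard : T.card = 2 := by rw [hTdef, Finset.card_erase_of_mem (mem_fc_self x B₀), hcx]
  have hTr : M.eRk (T : Set α) = 2 := by
    rw [(hI.subset (Finset.coe_subset.2 hTB)).eRk_eq_encard, Set.encard_coe_eq_coe_finsetCard, hTcard]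
    rfl
  -- the line through `T` contains `x`, `y` and the two points of `T`
  have hL := clF_mem_flatsQ_two hTr
  have hxL : x ∈ clF M T := by
    rw [mem_clF]
    have := hCx.mem_closure_sdiff_singleton_of_mem (Finset.mem_coe.2 (mem_fc_self x B₀))
    rwa [← Finset.coe_erase] at this
  have hyL : y ∈ clF M T := by
    rw [mem_clF]
    have := hCy.mem_closure_sdiff_singleton_of_mem (Finset.mem_coe.2 (mem_fc_self y B₀))
    rw [← Finset.coe_erase, ← hTeq', hTeq] at this
    exact this
  have hTL : T ⊆ clF M T := by
    rw [← Finset.coe_subset, coe_clF]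
    exact M.subset_closure _ (by rw [← coe_gr M]; exact_mod_cast (hTB.trans hBG).trans hG)
  have hxT : x ∉ T := fun h => (Finset.mem_erase.1 h).1 rfl
  have hyT : y ∉ T := fun h => hyB (hTB h)
  have hyxT : y ∉ insert x T := fun h => by
    rcases Finset.mem_insert.1 h with h' | h'
    · exact hxy h'.symm
    · exact hyT h'
  have hsubL : insert y (insert x T) ⊆ clF M T :=
    Finset.insert_subset hyL (Finset.insert_subset hxL hTL)
  have h4 := Finset.card_le_card hsubL
  rw [Finset.card_insert_of_notMem hyxT, Finset.card_insert_of_notMem hxT, hTcard] at h4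
  have := hline _ hL
  omega

/-! ## The charge dominates the charge from any sub-family -/

/-- The type-`2` term of a spanning non-basis is nonnegative. -/
theorem wTwo_nonneg_of_card_ne (hs : Simple M) {G B : Finset α} (hG : G ⊆ gr M) {q : ℕ} (hq : 2 ≤ q)
    (hB : B ∈ Rq M G q) (hc : B.card ≠ q) : 0 ≤ wTwo M G B q := by
  have h := typeTwo_term_pos_of_not_indep hs hG (mem_Rq.1 hB).1 (mem_Rq.1 hB).2 hq
    (not_indep_of_card_ne_of_mem_Rq hB hc)
  have hq' : (2 : ℚ) ≤ q := by exact_mod_cast hq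
  have h0 : (0 : ℚ) ≤ 2 / (((q : ℚ) - 1) * ((q : ℚ) + 1)) :=
    div_nonneg (by norm_num) (mul_nonneg (by linarith) (by linarith))
  unfold wTwo
  linarith

/-- **The charge dominates the charge from any sub-family of spanning non-bases above `B₀`.** -/
theorem charge_ge_sum_of_subset (hs : Simple M) {G : Finset α} (hG : G ⊆ gr M) {q : ℕ} (hq : 2 ≤ q)
    (B₀ : Finset α) {T : Finset (Finset α)} (hT : T ⊆ (Rq M G q).filter (fun B => B.card ≠ q ∧ B₀ ⊆ B)) :
    ∑ B ∈ T, wTwo M G B q / nb M G B q ≤ charge M G q B₀ := by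
  unfold charge
  apply Finset.sum_le_sum_of_subset_of_nonneg hT
  intro B hB _
  rw [Finset.mem_filter] at hB
  exact div_nonneg (wTwo_nonneg_of_card_ne hs hG hq hB.1 hB.2.1) (Nat.cast_nonneg _)

/-- `B₀ ∪ P` is a spanning set of `G` with `q + #P` points for `P ⊆ G ∖ B₀`. -/
theorem union_mem_Rq {G B₀ P : Finset α} {q : ℕ} (hrG : M.eRk (G : Set α) = (q : ℕ∞)) (hB : B₀ ∈ basesOf M G q)
    (hP : P ⊆ G \ B₀) : B₀ ∪ P ∈ Rq M G q ∧ (B₀ ∪ P).card = q + P.card := by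
  obtain ⟨hBG, _, hc⟩ := mem_basesOf.1 hB
  have hdisP : Disjoint B₀ P := by
    rw [Finset.disjoint_left]
    intro e he heP
    exact (Finset.mem_sdiff.1 (hP heP)).2 he
  have hPG : P ⊆ G := hP.trans Finset.sdiff_subset
  refine ⟨mem_Rq.2 ⟨Finset.union_subset hBG hPG,
    eRk_eq_of_basesOf_subset hrG hB Finset.subset_union_left (Finset.union_subset hBG hPG)⟩, ?_⟩
  rw [Finset.card_union_of_disjoint hdisP, hc]

/-- **The charge from the singletons and the pairs of `G ∖ B₀`** is a lower bound on the charge of `B₀`. -/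
theorem charge_ge_singles_add_pairs (hs : Simple M) {G B₀ : Finset α} {q : ℕ} (hG : G ⊆ gr M)
    (hrG : M.eRk (G : Set α) = (q : ℕ∞)) (hB : B₀ ∈ basesOf M G q) (hq : 2 ≤ q) :
    (∑ x ∈ G \ B₀, wTwo M G (insert x B₀) q / nb M G (insert x B₀) q) +
      ∑ P ∈ (G \ B₀).powersetCard 2, wTwo M G (B₀ ∪ P) q / nb M G (B₀ ∪ P) q ≤ charge M G q B₀ := by
  obtain ⟨hBG, hr, hc⟩ := mem_basesOf.1 hB
  set T₁ := (G \ B₀).image (fun x => insert x B₀) with hT₁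
  set T₂ := ((G \ B₀).powersetCard 2).image (fun P => B₀ ∪ P) with hT₂
  have hinj₁ : Set.InjOn (fun x => insert x B₀) ((G \ B₀ : Finset α) : Set α) := by
    intro x hx x' hx' hxx'
    simp only at hxx'
    have hxB : x ∉ B₀ := (Finset.mem_sdiff.1 (Finset.mem_coe.1 hx)).2
    have hx'B : x' ∉ B₀ := (Finset.mem_sdiff.1 (Finset.mem_coe.1 hx')).2
    have : x ∈ insert x' B₀ := by
      rw [← hxx']
      exact Finset.mem_insert_self x B₀
    rcases Finset.mem_insert.1 this with h | h
    · exact h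
    · exact absurd h hxB
  have hinj₂ : Set.InjOn (fun P => B₀ ∪ P) (((G \ B₀).powersetCard 2 : Finset (Finset α)) : Set (Finset α)) := by
    intro P hP P' hP' hPP'
    have hPsub : P ⊆ G \ B₀ := (Finset.mem_powersetCard.1 (Finset.mem_coe.1 hP)).1
    have hP'sub : P' ⊆ G \ B₀ := (Finset.mem_powersetCard.1 (Finset.mem_coe.1 hP')).1
    have hdis : ∀ {Q : Finset α}, Q ⊆ G \ B₀ → (B₀ ∪ Q) \ B₀ = Q := by
      intro Q hQ
      ext e
      rw [Finset.mem_sdiff, Finset.mem_union]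
      constructor
      · rintro ⟨h | h, h'⟩
        · exact absurd h h'
        · exact h
      · intro h
        exact ⟨Or.inr h, (Finset.mem_sdiff.1 (hQ h)).2⟩
    have := congrArg (fun S => S \ B₀) hPP'
    simp only at this
    rwa [hdis hPsub, hdis hP'sub] at this
  have hdisj : Disjoint T₁ T₂ := by
    rw [Finset.disjoint_left]
    intro S h₁ h₂
    rw [hT₁, Finset.mem_image] at h₁
    rw [hT₂, Finset.mem_image] at h₂
    obtain ⟨x, hx, rfl⟩ := h₁
    obtain ⟨P, hP, hPS⟩ := h₂
    have hxB : x ∉ B₀ := (Finset.mem_sdiff.1 hx).2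
    have hPsub : P ⊆ G \ B₀ := (Finset.mem_powersetCard.1 hP).1
    have hPc : P.card = 2 := (Finset.mem_powersetCard.1 hP).2
    have hdisP : Disjoint B₀ P := by
      rw [Finset.disjoint_left]
      intro e he heP
      exact (Finset.mem_sdiff.1 (hPsub heP)).2 he
    have h1 := congrArg Finset.card hPS
    rw [Finset.card_union_of_disjoint hdisP, Finset.card_insert_of_notMem hxB, hPc] at h1
    omega
  have hsub : T₁ ∪ T₂ ⊆ (Rq M G q).filter (fun B => B.card ≠ q ∧ B₀ ⊆ B) := by
    intro S hS
    rw [Finset.mem_filter]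
    rcases Finset.mem_union.1 hS with h₁ | h₂
    · rw [hT₁, Finset.mem_image] at h₁
      obtain ⟨x, hx, rfl⟩ := h₁
      have hxG : x ∈ G := (Finset.mem_sdiff.1 hx).1
      have hxB : x ∉ B₀ := (Finset.mem_sdiff.1 hx).2
      refine ⟨insert_mem_Rq hrG hB hxG, ?_, Finset.subset_insert x B₀⟩
      rw [Finset.card_insert_of_notMem hxB, hc]
      omega
    · rw [hT₂, Finset.mem_image] at h₂
      obtain ⟨P, hP, rfl⟩ := h₂
      have hPsub : P ⊆ G \ B₀ := (Finset.mem_powersetCard.1 hP).1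
      have hPc : P.card = 2 := (Finset.mem_powersetCard.1 hP).2
      have hdisP : Disjoint B₀ P := by
        rw [Finset.disjoint_left]
        intro e he heP
        exact (Finset.mem_sdiff.1 (hPsub heP)).2 he
      have hPG : P ⊆ G := hPsub.trans Finset.sdiff_subset
      refine ⟨mem_Rq.2 ⟨Finset.union_subset hBG hPG,
        eRk_eq_of_basesOf_subset hrG hB Finset.subset_union_left (Finset.union_subset hBG hPG)⟩, ?_,
        Finset.subset_union_left⟩
      rw [Finset.card_union_of_disjoint hdisP, hc, hPc]
      omega
  have h := charge_ge_sum_of_subset hs hG hq B₀ hsub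
  rw [Finset.sum_union hdisj, hT₁, hT₂, Finset.sum_image hinj₁, Finset.sum_image hinj₂] at h
  exact h

/-! ## The share from a singleton -/

/-- **The share of `B₀` from `B₀ ∪ {x}`** is at least `(q/(q + 2 − #C) − Φ_q·dem(B₀ ∪ {x}))/#C` with `C` the
fundamental circuit of `x`. -/
theorem single_share_ge (hs : Simple M) {G B₀ : Finset α} {q : ℕ} (hG : G ⊆ gr M)
    (hrG : M.eRk (G : Set α) = (q : ℕ∞)) (hB : B₀ ∈ basesOf M G q) (hq : 2 ≤ q) {x : α} (hx : x ∈ G)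
    (hxB : x ∉ B₀) :
    ((q : ℚ) / ((q : ℚ) + 2 - (fc M x B₀).card) - ((q : ℚ) + 2) / ((q : ℚ) + 1) * dem M G 2 (insert x B₀)) /
      (fc M x B₀).card ≤ wTwo M G (insert x B₀) q / nb M G (insert x B₀) q := by
  have hR := insert_mem_Rq hrG hB hx
  obtain ⟨hBG, hr, hc⟩ := mem_basesOf.1 hB
  have hcard : (insert x B₀).card ≠ q := by
    rw [Finset.card_insert_of_notMem hxB, hc]
    omega
  have hw0 : 0 ≤ wTwo M G (insert x B₀) q := wTwo_nonneg_of_card_ne hs hG hq hR hcard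
  have hnb := nb_insert_le hG hrG hB hx hxB
  have hnb1 := one_le_nb hR
  have hm := mTr_insert_add_card_fc_le hG hrG hB hx hxB
  have h3 := three_le_card_fc hs (hBG.trans hG) (hG hx) (indep_of_mem_basesOf hB)
    (mem_closure_of_mem_basesOf hG hrG hB hx) hxB (Finset.card_pos.1 (by omega))
  have hcpos : (0 : ℚ) < (fc M x B₀).card := by exact_mod_cast (by omega : 0 < (fc M x B₀).card)
  have hnbpos : (0 : ℚ) < nb M G (insert x B₀) q := by
    exact_mod_cast (by omega : 0 < nb M G (insert x B₀) q)
  have hnb' : (nb M G (insert x B₀) q : ℚ) ≤ (fc M x B₀).card := by exact_mod_cast hnb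
  have hwlow : (q : ℚ) / ((q : ℚ) + 2 - (fc M x B₀).card) -
      ((q : ℚ) + 2) / ((q : ℚ) + 1) * dem M G 2 (insert x B₀) ≤ wTwo M G (insert x B₀) q := by
    unfold wTwo wInf
    have hm' : (mTr M (insert x B₀) : ℚ) + (fc M x B₀).card ≤ q + 1 := by exact_mod_cast hm
    have hden : (0 : ℚ) < (q : ℚ) + 2 - (fc M x B₀).card := by
      linarith [(Nat.cast_nonneg (mTr M (insert x B₀)) : (0 : ℚ) ≤ _)]
    have hwinf : (q : ℚ) / ((q : ℚ) + 2 - (fc M x B₀).card) ≤ (q : ℚ) * (1 / (1 + (mTr M (insert x B₀) : ℚ))) := by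
      rw [mul_one_div]
      exact div_le_div_of_nonneg_left (Nat.cast_nonneg q) (by positivity) (by linarith)
    push_cast
    linarith
  calc ((q : ℚ) / ((q : ℚ) + 2 - (fc M x B₀).card) - ((q : ℚ) + 2) / ((q : ℚ) + 1) * dem M G 2 (insert x B₀)) /
        (fc M x B₀).card ≤ wTwo M G (insert x B₀) q / (fc M x B₀).card :=
      div_le_div_of_nonneg_right hwlow hcpos.le
    _ ≤ wTwo M G (insert x B₀) q / nb M G (insert x B₀) q := div_le_div_of_nonneg_left hw0 hnbpos hnb'

end PercRepro.GenQ
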